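import Summits.MatrixMultiplication.OmegaCensus.STPPFatQuotientLift
import Summits.MatrixMultiplication.OmegaCensus.STPPFiberLift
import Summits.MatrixMultiplication.OmegaCensus.STPPSmallPatternCyclicRaysT1K8
import Summits.MatrixMultiplication.OmegaCensus.STPPSmallPatternCyclicRaysT1K9
import Summits.MatrixMultiplication.OmegaCensus.STPPSmallPatternCyclicRaysT1K10
import Summits.MatrixMultiplication.OmegaCensus.STPPSmallPatternCyclicRaysT1K11
import Summits.MatrixMultiplication.OmegaCensus.STPPSmallPatternCyclicRaysT1K12
import Summits.MatrixMultiplication.OmegaCensus.STPPSmallPatternCyclicRaysT2K6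
import Summits.MatrixMultiplication.OmegaCensus.STPPSmallPatternCyclicRaysT2K7
import Summits.MatrixMultiplication.OmegaCensus.STPPSmallPatternCyclicRaysT2K8
import Summits.MatrixMultiplication.OmegaCensus.STPPSmallPatternCyclicThreeAPFreeRungs

/-!
# ω-census, small patterns: the CYCLIC fat lifts `ℤ/n ↠ … ↞ ℤ/2n` instantiated — every `T1` host `m` is a `T2` host `2m`

Cell `pub-omega`, ω construction census, seat pub-omega ENG2 (gen 33). HONEST FRAMING (verbatim): lottery ticket; floor =
certified bounds/negative ranges.  Census STRUCTURE bookkeeping for column B5 (cyclic `T2` cells and the cyclic `(2,2,2)^k` column);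
nothing here bears on `ω`.

The tree has the FAT LIFT along any surjection with kernel of order `2` (`exists_isSTPP_122_of_211_of_surjective`,
`STPPFatQuotientLift.lean`, ENG2 gen 31: `(2,1,1)^k ⊆ Q ⇒ (1,2,2)^k ⊆ G`) and the singleton-mixed lift `ℤ/2n → ℤ/n` for `(2,2,2)^k`
(`exists_isSTPP_222pow_zmod_two_mul`, `STPPFiberLift.lean`).  The census instances of the first were filed by `decide` one modulus at a
time (`STPPSmallPatternT2LiftsK7K8/K8K11.lean`).  Here the reduction map `ℤ/2n → ℤ/n` (surjective, kernel `{0, n}` of order `2` by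
`card_fiber_mul_card` — also for EVEN `n`, where the extension does not split) is plugged in once:

* `exists_isSTPP_122pow_zmod_two_mul_of_211pow` — **`(2,1,1)^k ⊆ ℤ/n ⇒ (1,2,2)^k ⊆ ℤ/2n`** (`n ≥ 1`, all `k`);
* `exists_isSTPP_222pow_zmod_two_mul_of_122pow` — **`(1,2,2)^k ⊆ ℤ/n ⇒ (2,2,2)^k ⊆ ℤ/2n`**; hence
  `exists_isSTPP_222pow_zmod_four_mul_of_211pow` — **`(2,1,1)^k ⊆ ℤ/n ⇒ (2,2,2)^k ⊆ ℤ/4n`**;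

and then fed with the kernel `T1` rays of ENG2 gen 32 (`…CyclicRaysT1K9…K12`, `k = 7, 8` from `…CyclicRaysT1`/`T1K8`) and gen 33
(`…211pow13_zmod_of_le118`).  NEW `T2` CELLS of the B5 table (all by `(2,1,1)^k ⊆ ℤ/n ⇒ (1,2,2)^k ⊆ ℤ/2n`):
`(1,2,2)⁷ ⊆ ℤ/78, ℤ/82` (the `k = 7` cyclic column now reads: every `m ≥ 76` except possibly `77, 79`); `(1,2,2)⁸ ⊆ ℤ/98` (every
`m ≥ 96` except possibly `97, 99`); `(1,2,2)⁹ ⊆ ℤ/m` for every EVEN `m ≥ 122` (record: `122, 128`, ray from `156`); `(1,2,2)¹⁰`: `140` and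
every even `m ≥ 144` (ray from `188`); `(1,2,2)¹¹`: `164, 168` and every even `m ≥ 172` (ray from `204`); `(1,2,2)¹²`: `192` and every even
`m ≥ 196` (ray `236`); `(1,2,2)¹³`: `232` and every even `m ≥ 236` (ray `252`).  For the `(2,2,2)^k` column: `(2,2,2)^k ⊆ ℤ/2m` for every
`T2` host `m`, e.g. `(2,2,2)⁶ ⊆ ℤ/m` for `m = 120, 124` and every even `m ≥ 128`; `(2,2,2)⁷ ⊆ ℤ/m` for `m = 152, 156, 160, 162, 164` and every
even `m ≥ 166`; `(2,2,2)⁸ ⊆ ℤ/m` for `m = 192, 196` and every even `m ≥ 200` (the 3-AP law of `STPP222PowCyclicThreeAPFree` gives all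
`m ≥ 168 / 200 / 216`).  No NONE cell and no onset is claimed.

References: H. Cohn, R. Kleinberg, B. Szegedy, C. Umans, *Group-theoretic algorithms for matrix multiplication*, FOCS 2005
(arXiv:math/0511460), Def. 5.1.  Seat pub-omega ENG2 (gen 33), 2026-08-28.
-/

open Literature.Computability.AlgebraicComplexity Finset

namespace Summit.MatrixMultiplication.OmegaCensus

/-! ## The reduction map `ℤ/2n → ℤ/n` and the three cyclic lifts -/

/-- The kernel of the reduction `ℤ/2n → ℤ/n` has exactly two elements (`|fibre| · n = 2n`, `card_fiber_mul_card`). [folklore] -/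
theorem card_ker_castHom_two_mul (n : ℕ) [NeZero n] :
    haveI : NeZero (2 * n) := ⟨by have := NeZero.ne n; omega⟩
    ((univ : Finset (ZMod (2 * n))).filter
        (fun g => (ZMod.castHom (Dvd.intro_left 2 rfl : n ∣ 2 * n) (ZMod n)).toAddMonoidHom g = 0)).card = 2 := by
  haveI : NeZero (2 * n) := ⟨by have := NeZero.ne n; omega⟩
  have hdvd : n ∣ 2 * n := Dvd.intro_left 2 rfl
  have h := card_fiber_mul_card ((ZMod.castHom hdvd (ZMod n)).toAddMonoidHom) (ZMod.castHom_surjective hdvd) 0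
  rw [ZMod.card, ZMod.card] at h
  have hn : 0 < n := Nat.pos_of_ne_zero (NeZero.ne n)
  exact Nat.eq_of_mul_eq_mul_right hn (by rw [h])

/-- **`(2,1,1)^k ⊆ ℤ/n ⇒ (1,2,2)^k ⊆ ℤ/2n`** (`n ≥ 1`; fat lift of the `C`-points along `ℤ/2n → ℤ/n`, roles rotated — the tree's
`exists_isSTPP_122_of_211_of_surjective`). Census reading: every cyclic `T1` host `m` gives the cyclic `T2` host `2m`.
[cite: CohnKleinbergSzegedyUmans2005, Def. 5.1] -/
theorem exists_isSTPP_122pow_zmod_two_mul_of_211pow {n k : ℕ} [NeZero n]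
    (h : ∃ A B C : Fin k → Finset (ZMod n), IsSTPP A B C ∧ ∀ i, (A i).card = 2 ∧ (B i).card = 1 ∧ (C i).card = 1) :
    ∃ A B C : Fin k → Finset (ZMod (2 * n)), IsSTPP A B C ∧ ∀ i, (A i).card = 1 ∧ (B i).card = 2 ∧ (C i).card = 2 := by
  haveI : NeZero (2 * n) := ⟨by have := NeZero.ne n; omega⟩
  have hdvd : n ∣ 2 * n := Dvd.intro_left 2 rfl
  exact exists_isSTPP_122_of_211_of_surjective ((ZMod.castHom hdvd (ZMod n)).toAddMonoidHom) (ZMod.castHom_surjective hdvd)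
    (card_ker_castHom_two_mul n) h

/-- **`(1,2,2)^k ⊆ ℤ/n ⇒ (2,2,2)^k ⊆ ℤ/2n`** (the tree's singleton-mixed lift `exists_isSTPP_222pow_zmod_two_mul` on a family whose
singleton always sits in the `A`-role). [cite: CohnKleinbergSzegedyUmans2005, Def. 5.1] -/
theorem exists_isSTPP_222pow_zmod_two_mul_of_122pow {n k : ℕ} [NeZero n]
    (h : ∃ A B C : Fin k → Finset (ZMod n), IsSTPP A B C ∧ ∀ i, (A i).card = 1 ∧ (B i).card = 2 ∧ (C i).card = 2) :
    ∃ A B C : Fin k → Finset (ZMod (2 * n)), IsSTPP A B C ∧ ∀ i, (A i).card = 2 ∧ (B i).card = 2 ∧ (C i).card = 2 := by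
  obtain ⟨A, B, C, hS, hc⟩ := h
  exact exists_isSTPP_222pow_zmod_two_mul hS (fun i => Or.inl (hc i))

/-- **`(2,1,1)^k ⊆ ℤ/n ⇒ (2,2,2)^k ⊆ ℤ/4n`** (the two lifts in a row). Census reading: every cyclic `T1` host `m` gives the cyclic
`(2,2,2)^k` host `4m`. [cite: CohnKleinbergSzegedyUmans2005, Def. 5.1] -/
theorem exists_isSTPP_222pow_zmod_four_mul_of_211pow {n k : ℕ} [NeZero n]
    (h : ∃ A B C : Fin k → Finset (ZMod n), IsSTPP A B C ∧ ∀ i, (A i).card = 2 ∧ (B i).card = 1 ∧ (C i).card = 1) :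
    ∃ A B C : Fin k → Finset (ZMod (4 * n)), IsSTPP A B C ∧ ∀ i, (A i).card = 2 ∧ (B i).card = 2 ∧ (C i).card = 2 := by
  haveI : NeZero (2 * n) := ⟨by have := NeZero.ne n; omega⟩
  rw [show 4 * n = 2 * (2 * n) by ring]
  exact exists_isSTPP_222pow_zmod_two_mul_of_122pow (exists_isSTPP_122pow_zmod_two_mul_of_211pow h)

/-- Even-modulus packaging: if `(2,1,1)^k ⊆ ℤ/n` for every `n ≥ a` (a cyclic `T1` ray), then `(1,2,2)^k ⊆ ℤ/m` for every EVEN `m ≥ 2a`.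
[cite: CohnKleinbergSzegedyUmans2005, Def. 5.1] -/
theorem exists_isSTPP_122pow_zmod_of_even_of_ray {k a : ℕ} (ha : 0 < a)
    (hray : ∀ n, a ≤ n → ∃ A B C : Fin k → Finset (ZMod n), IsSTPP A B C ∧ ∀ i, (A i).card = 2 ∧ (B i).card = 1 ∧ (C i).card = 1)
    (m : ℕ) (hm : 2 * a ≤ m) (he : Even m) :
    ∃ A B C : Fin k → Finset (ZMod m), IsSTPP A B C ∧ ∀ i, (A i).card = 1 ∧ (B i).card = 2 ∧ (C i).card = 2 := by
  obtain ⟨n, rfl⟩ := he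
  rw [← two_mul] at hm ⊢
  haveI : NeZero n := ⟨by omega⟩
  exact exists_isSTPP_122pow_zmod_two_mul_of_211pow (hray n (by omega))

/-- Even-modulus packaging for `(2,2,2)^k`: a cyclic `T2` ray from `a` gives `(2,2,2)^k ⊆ ℤ/m` for every EVEN `m ≥ 2a`.
[cite: CohnKleinbergSzegedyUmans2005, Def. 5.1] -/
theorem exists_isSTPP_222pow_zmod_of_even_of_ray {k a : ℕ} (ha : 0 < a)
    (hray : ∀ n, a ≤ n → ∃ A B C : Fin k → Finset (ZMod n), IsSTPP A B C ∧ ∀ i, (A i).card = 1 ∧ (B i).card = 2 ∧ (C i).card = 2)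
    (m : ℕ) (hm : 2 * a ≤ m) (he : Even m) :
    ∃ A B C : Fin k → Finset (ZMod m), IsSTPP A B C ∧ ∀ i, (A i).card = 2 ∧ (B i).card = 2 ∧ (C i).card = 2 := by
  obtain ⟨n, rfl⟩ := he
  rw [← two_mul] at hm ⊢
  haveI : NeZero n := ⟨by omega⟩
  exact exists_isSTPP_222pow_zmod_two_mul_of_122pow (hray n (by omega))

/-! ## `T2` cells from the kernel `T1` rays (`k = 7 … 13`) -/

/-- **`(1,2,2)⁷ ⊆ ℤ/78` and `⊆ ℤ/82`** (lifts of `(2,1,1)⁷ ⊆ ℤ/39`, `ℤ/41`, ray `…211pow7_zmod_of_le`): two of the four open cells of the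
`k = 7` cyclic column. [cite: CohnKleinbergSzegedyUmans2005, Def. 5.1] -/
theorem exists_isSTPP_122pow7_zmod78_zmod82 :
    (∃ A B C : Fin 7 → Finset (ZMod 78), IsSTPP A B C ∧ ∀ i, (A i).card = 1 ∧ (B i).card = 2 ∧ (C i).card = 2) ∧
    (∃ A B C : Fin 7 → Finset (ZMod 82), IsSTPP A B C ∧ ∀ i, (A i).card = 1 ∧ (B i).card = 2 ∧ (C i).card = 2) :=
  ⟨exists_isSTPP_122pow_zmod_two_mul_of_211pow (n := 39) (exists_isSTPP_211pow7_zmod_of_le 39 (by norm_num)),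
    exists_isSTPP_122pow_zmod_two_mul_of_211pow (n := 41) (exists_isSTPP_211pow7_zmod_of_le 41 (by norm_num))⟩

/-- **The `k = 7` cyclic `T2` column: `(1,2,2)⁷ ⊆ ℤ/m` for every `m ≥ 76` except possibly `m ∈ {77, 79}`** (gen 32's
`…122pow7_zmod_of_le76_of_not_mem` + the two lifts). [cite: CohnKleinbergSzegedyUmans2005, Def. 5.1] -/
theorem exists_isSTPP_122pow7_zmod_of_le76_of_not_mem' (m : ℕ) (hm : 76 ≤ m) (hex : m ∉ ({77, 79} : Finset ℕ)) :
    ∃ A B C : Fin 7 → Finset (ZMod m), IsSTPP A B C ∧ ∀ i, (A i).card = 1 ∧ (B i).card = 2 ∧ (C i).card = 2 := by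
  simp only [Finset.mem_insert, Finset.mem_singleton, not_or] at hex
  by_cases h78 : m = 78
  · subst h78; exact exists_isSTPP_122pow7_zmod78_zmod82.1
  by_cases h82 : m = 82
  · subst h82; exact exists_isSTPP_122pow7_zmod78_zmod82.2
  exact exists_isSTPP_122pow7_zmod_of_le76_of_not_mem m hm (by simp; omega)

/-- **`(1,2,2)⁸ ⊆ ℤ/98`** (lift of `(2,1,1)⁸ ⊆ ℤ/49`); so **`(1,2,2)⁸ ⊆ ℤ/m` for every `m ≥ 96` except possibly `m ∈ {97, 99}`.**
[cite: CohnKleinbergSzegedyUmans2005, Def. 5.1] -/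
theorem exists_isSTPP_122pow8_zmod_of_le96_of_not_mem' (m : ℕ) (hm : 96 ≤ m) (hex : m ∉ ({97, 99} : Finset ℕ)) :
    ∃ A B C : Fin 8 → Finset (ZMod m), IsSTPP A B C ∧ ∀ i, (A i).card = 1 ∧ (B i).card = 2 ∧ (C i).card = 2 := by
  simp only [Finset.mem_insert, Finset.mem_singleton, not_or] at hex
  by_cases h98 : m = 98
  · subst h98
    exact exists_isSTPP_122pow_zmod_two_mul_of_211pow (n := 49) (exists_isSTPP_211pow8_zmod_of_le48 49 (by norm_num))
  exact exists_isSTPP_122pow8_zmod_of_le96_of_not_mem m hm (by simp; omega)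

/-- **`(1,2,2)⁹ ⊆ ℤ/m` for every even `m ≥ 122`** (lift of the `T1` ray from `61`) **and every `m ≥ 156`** (3-AP rung).
[cite: CohnKleinbergSzegedyUmans2005, Def. 5.1] -/
theorem exists_isSTPP_122pow9_zmod_of_even_or_le (m : ℕ) (hm : 122 ≤ m) (h : Even m ∨ 156 ≤ m) :
    ∃ A B C : Fin 9 → Finset (ZMod m), IsSTPP A B C ∧ ∀ i, (A i).card = 1 ∧ (B i).card = 2 ∧ (C i).card = 2 := by
  by_cases h156 : 156 ≤ m
  · exact exists_isSTPP_122pow9_zmod_of_le156 m h156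
  · have he : Even m := h.resolve_right h156
    exact exists_isSTPP_122pow_zmod_of_even_of_ray (by norm_num) exists_isSTPP_211pow9_zmod_of_le61 m hm he

/-- **`(1,2,2)¹⁰ ⊆ ℤ/m` for `m = 140`, every even `m ≥ 144`, and every `m ≥ 188`** (lifts of `ℤ/70` and the `T1` ray from `72`; 3-AP rung).
[cite: CohnKleinbergSzegedyUmans2005, Def. 5.1] -/
theorem exists_isSTPP_122pow10_zmod_of (m : ℕ) (h : m = 140 ∨ (144 ≤ m ∧ Even m) ∨ 188 ≤ m) :
    ∃ A B C : Fin 10 → Finset (ZMod m), IsSTPP A B C ∧ ∀ i, (A i).card = 1 ∧ (B i).card = 2 ∧ (C i).card = 2 := by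
  by_cases h188 : 188 ≤ m
  · exact exists_isSTPP_122pow10_zmod_of_le188 m h188
  rcases h with rfl | ⟨hm, he⟩ | h
  · exact exists_isSTPP_122pow_zmod_two_mul_of_211pow (n := 70) exists_isSTPP_211pow10_zmod70
  · exact exists_isSTPP_122pow_zmod_of_even_of_ray (by norm_num) exists_isSTPP_211pow10_zmod_of_le m hm he
  · exact absurd h h188

/-- **`(1,2,2)¹¹ ⊆ ℤ/m` for `m = 164, 168`, every even `m ≥ 172`, and every `m ≥ 204`** (lifts of `ℤ/82`, `ℤ/84` and the `T1` ray from `86`;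
3-AP rung). [cite: CohnKleinbergSzegedyUmans2005, Def. 5.1] -/
theorem exists_isSTPP_122pow11_zmod_of (m : ℕ) (h : m = 164 ∨ m = 168 ∨ (172 ≤ m ∧ Even m) ∨ 204 ≤ m) :
    ∃ A B C : Fin 11 → Finset (ZMod m), IsSTPP A B C ∧ ∀ i, (A i).card = 1 ∧ (B i).card = 2 ∧ (C i).card = 2 := by
  by_cases h204 : 204 ≤ m
  · exact exists_isSTPP_122pow11_zmod_of_le204 m h204
  rcases h with rfl | rfl | ⟨hm, he⟩ | h
  · exact exists_isSTPP_122pow_zmod_two_mul_of_211pow (n := 82) exists_isSTPP_211pow11_zmod82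
  · exact exists_isSTPP_122pow_zmod_two_mul_of_211pow (n := 84) exists_isSTPP_211pow11_zmod84
  · exact exists_isSTPP_122pow_zmod_of_even_of_ray (by norm_num) exists_isSTPP_211pow11_zmod_of_le m hm he
  · exact absurd h h204

/-- **`(1,2,2)¹² ⊆ ℤ/m` for `m = 192`, every even `m ≥ 196`, and every `m ≥ 236`** (lifts of `ℤ/96` and the `T1` ray from `98`; 3-AP rung).
[cite: CohnKleinbergSzegedyUmans2005, Def. 5.1] -/
theorem exists_isSTPP_122pow12_zmod_of (m : ℕ) (h : m = 192 ∨ (196 ≤ m ∧ Even m) ∨ 236 ≤ m) :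
    ∃ A B C : Fin 12 → Finset (ZMod m), IsSTPP A B C ∧ ∀ i, (A i).card = 1 ∧ (B i).card = 2 ∧ (C i).card = 2 := by
  by_cases h236 : 236 ≤ m
  · exact exists_isSTPP_122pow12_zmod_of_le236 m h236
  rcases h with rfl | ⟨hm, he⟩ | h
  · exact exists_isSTPP_122pow_zmod_two_mul_of_211pow (n := 96) exists_isSTPP_211pow12_zmod96
  · exact exists_isSTPP_122pow_zmod_of_even_of_ray (by norm_num) exists_isSTPP_211pow12_zmod_of_le m hm he
  · exact absurd h h236

/-- **`(1,2,2)¹³ ⊆ ℤ/m` for `m = 232`, every even `m ≥ 236`, and every `m ≥ 252`** (lifts of `ℤ/116` and the `T1` ray from `118`; 3-AP rung).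
[cite: CohnKleinbergSzegedyUmans2005, Def. 5.1] -/
theorem exists_isSTPP_122pow13_zmod_of (m : ℕ) (h : m = 232 ∨ (236 ≤ m ∧ Even m) ∨ 252 ≤ m) :
    ∃ A B C : Fin 13 → Finset (ZMod m), IsSTPP A B C ∧ ∀ i, (A i).card = 1 ∧ (B i).card = 2 ∧ (C i).card = 2 := by
  by_cases h252 : 252 ≤ m
  · exact exists_isSTPP_122pow13_zmod_of_le252 m h252
  rcases h with rfl | ⟨hm, he⟩ | h
  · exact exists_isSTPP_122pow_zmod_two_mul_of_211pow (n := 116) exists_isSTPP_211pow13_zmod116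
  · exact exists_isSTPP_122pow_zmod_of_even_of_ray (by norm_num) exists_isSTPP_211pow13_zmod_of_le118 m hm he
  · exact absurd h h252

/-! ## `(2,2,2)^k` cells from the kernel `T2` rays (`k = 6, 7, 8`) -/

/-- **`(2,2,2)⁶ ⊆ ℤ/m` for `m = 120, 124` and every even `m ≥ 128`** (lifts of the `T2` hosts `60, 62` and the ray from `64`).
[cite: CohnKleinbergSzegedyUmans2005, Def. 5.1] -/
theorem exists_isSTPP_222pow6_zmod_of_even (m : ℕ) (h : m = 120 ∨ m = 124 ∨ (128 ≤ m ∧ Even m)) :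
    ∃ A B C : Fin 6 → Finset (ZMod m), IsSTPP A B C ∧ ∀ i, (A i).card = 2 ∧ (B i).card = 2 ∧ (C i).card = 2 := by
  rcases h with rfl | rfl | ⟨hm, he⟩
  · exact exists_isSTPP_222pow_zmod_two_mul_of_122pow (n := 60)
      (exists_isSTPP_122pow6_zmod_of_le60_of_not_mem 60 le_rfl (by decide))
  · exact exists_isSTPP_222pow_zmod_two_mul_of_122pow (n := 62)
      (exists_isSTPP_122pow6_zmod_of_le60_of_not_mem 62 (by norm_num) (by decide))
  · exact exists_isSTPP_222pow_zmod_of_even_of_ray (by norm_num) exists_isSTPP_122pow6_zmod_of_le64 m hm he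

/-- **`(2,2,2)⁷ ⊆ ℤ/m` for `m ∈ {152, 156, 160, 162, 164}` and every even `m ≥ 166`** (lifts of the `T2` hosts `76, 78, 80, 81, 82` and the ray
from `83`). [cite: CohnKleinbergSzegedyUmans2005, Def. 5.1] -/
theorem exists_isSTPP_222pow7_zmod_of_even (m : ℕ) (h : m ∈ ({152, 156, 160, 162, 164} : Finset ℕ) ∨ (166 ≤ m ∧ Even m)) :
    ∃ A B C : Fin 7 → Finset (ZMod m), IsSTPP A B C ∧ ∀ i, (A i).card = 2 ∧ (B i).card = 2 ∧ (C i).card = 2 := by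
  rcases h with h | ⟨hm, he⟩
  · simp only [Finset.mem_insert, Finset.mem_singleton] at h
    rcases h with rfl | rfl | rfl | rfl | rfl
    · exact exists_isSTPP_222pow_zmod_two_mul_of_122pow (n := 76)
        (exists_isSTPP_122pow7_zmod_of_le76_of_not_mem' 76 le_rfl (by decide))
    · exact exists_isSTPP_222pow_zmod_two_mul_of_122pow (n := 78)
        (exists_isSTPP_122pow7_zmod_of_le76_of_not_mem' 78 (by norm_num) (by decide))
    · exact exists_isSTPP_222pow_zmod_two_mul_of_122pow (n := 80)
        (exists_isSTPP_122pow7_zmod_of_le76_of_not_mem' 80 (by norm_num) (by decide))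
    · exact exists_isSTPP_222pow_zmod_two_mul_of_122pow (n := 81)
        (exists_isSTPP_122pow7_zmod_of_le76_of_not_mem' 81 (by norm_num) (by decide))
    · exact exists_isSTPP_222pow_zmod_two_mul_of_122pow (n := 82)
        (exists_isSTPP_122pow7_zmod_of_le76_of_not_mem' 82 (by norm_num) (by decide))
  · exact exists_isSTPP_222pow_zmod_of_even_of_ray (by norm_num) exists_isSTPP_122pow7_zmod_of_le83 m hm he

/-- **`(2,2,2)⁸ ⊆ ℤ/m` for `m = 192, 196` and every even `m ≥ 200`** (lifts of the `T2` hosts `96, 98` and the ray from `100`).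
[cite: CohnKleinbergSzegedyUmans2005, Def. 5.1] -/
theorem exists_isSTPP_222pow8_zmod_of_even (m : ℕ) (h : m = 192 ∨ m = 196 ∨ (200 ≤ m ∧ Even m)) :
    ∃ A B C : Fin 8 → Finset (ZMod m), IsSTPP A B C ∧ ∀ i, (A i).card = 2 ∧ (B i).card = 2 ∧ (C i).card = 2 := by
  rcases h with rfl | rfl | ⟨hm, he⟩
  · exact exists_isSTPP_222pow_zmod_two_mul_of_122pow (n := 96)
      (exists_isSTPP_122pow8_zmod_of_le96_of_not_mem' 96 le_rfl (by decide))
  · exact exists_isSTPP_222pow_zmod_two_mul_of_122pow (n := 98)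
      (exists_isSTPP_122pow8_zmod_of_le96_of_not_mem' 98 (by norm_num) (by decide))
  · exact exists_isSTPP_222pow_zmod_of_even_of_ray (by norm_num) exists_isSTPP_122pow8_zmod_of_le100 m hm he

end Summit.MatrixMultiplication.OmegaCensus
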